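import Literature.Probability.RandomPlanarGeometry.HexSAWBrickWallStripFugacityWidthOneContactVariance
import HarnessLib

/-!
# Gaussian asymptotics of the moment generating function of the contact number:
# `E_{N,y,z} exp(s·(bc − N·b)/√N) → exp(σ²s²/2)` for every real `s`, `σ² = ∂b/∂log y`

Topic `Literature/Probability/RandomPlanarGeometry` (continues `HexSAWBrickWallStripFugacityWidthOneContactVariance.lean` (the variance theorem
`Var_{N,y,z}(bc)/N → σ² = d/dA b(e^A,z)|_{A=log y}`, the `C²` free energy `Λ(A) = log μ₁(e^A,e^B)`, the positive continuous parity amplitudes) and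
`…UniformAmplitude.lean` (the uniform remainder `log C_{1,N}(e^A,z) = NΛ(A) + log A_{N mod 2}(e^A,z) + r_N(A)`, `sup_{|A−A₀|≤1}|r_N| ≤ ε_{⌊N/2⌋} → 0`)).
THIS FILE proves the Gaussian limit of the moment generating functions of the centred, `√N`-scaled number of bottom contacts:

  ★★★ `tendsto_contactMGF_gaussian`: for all `y, z > 0` and EVERY real `s`,
      `C_{1,N}(y e^{s/√N}, z)/C_{1,N}(y,z) · e^{−s√N·b(y,z)} → exp(σ²s²/2)`,
      i.e. `E_{N,y,z}[e^{s(bc − N b)/√N}] → E[e^{sZ}]`, `Z ~ N(0, σ²)`, `σ² = d/dA b(e^A, z)|_{A = log y}` —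
      convergence of the moment generating functions on the whole line, the classical sufficient condition for the central limit theorem
      `(bc − N b)/√N ⇒ N(0, σ²)` (Curtiss' theorem; the weak-convergence step itself is not formalised here).

Proof: `log E e^{s(bc−Nb)/√N} = N[Λ(A₀+u) − Λ(A₀) − b u] + [log A_c(e^{A₀+u}) − log A_c(e^{A₀})] + [r_N(A₀+u) − r_N(A₀)]`, `u = s/√N`,
`c = N mod 2`; the first bracket is `σ²s²/2 + Nψ(u)` with `|ψ(u)| ≤ η u²` for `|u| ≤ δ(η)` (§1, two mean-value steps on `ψ'' = Λ''(A₀+·) − Λ''(A₀)`,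
continuous and vanishing at `0`), so `N|ψ(u)| ≤ η s²`; the second → 0 by continuity; the third is `≤ 2ε_{⌊N/2⌋} → 0`.
* §1 (private) `derivData_of_contDiff_two''` (plumbing copy), `abs_le_of_second_deriv_bound` (`ψ(0) = ψ'(0) = 0`, `|ψ''| ≤ η` on `[−δ,δ]`
  ⇒ `|ψ(u)| ≤ ηu²`).
* §2 (private) `tendsto_nat_div_two`, ★★★ `tendsto_contactMGF_gaussian`.

Numerics (`mgf_check.py`, exact bivariate enumeration): `(y,z) = (2,1)`, `σ² = 0.185942`: `M_N(1) = 1.09790, 1.09811, 1.09812, 1.09803`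
(`N = 50, 100, 200, 400`) vs `e^{σ²/2} = 1.09743`; `M_N(2) → 1.45050` vs `1.45046`.  `(1,1)`, `σ² = 0.140549`: `M_N(1) = 1.1095, 1.0993, 1.0918, 1.0864`
vs `1.0728` — the visible `O(1/√N)` drift is exactly the mean correction `e^{sγ/√N}` of `…ContactMeanCorrection.lean` (`γ(1,1) = 0.2419`:
`e^{0.2419/20}·1.0728 = 1.0859` at `N = 400`).

## Sources
A. Dembo, O. Zeitouni, *Large Deviations Techniques and Applications* (2010) §2.3 (local expansion of the limiting logarithmic moment generating
function; lane statement of the Gaussian consequence); N. Madras, G. Slade, *The Self-Avoiding Walk* (1993) §1.1 eq. (1.1.4) p. 5; N. R. Beaton,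
M. Bousquet-Mélou, J. de Gier, H. Duminil-Copin, A. J. Guttmann, CMP 326 (2014), arXiv:1109.0358v5 §3.2 Proposition 6 (p. 10).  Nothing is quoted
AS PRINTED; the statement and constants are this lineage's.
-/

noncomputable section

open Filter Topology Finset Set Literature.Analysis Literature.Probability.Moments
open Literature.Probability.LatticeModels Literature.Probability.Percolation

namespace Literature.Probability.RandomPlanarGeometry.SAW.HexBW

namespace WidthOneYZ

variable {y z : ℝ}

/-! ## §1 A second-order Taylor squeeze from derivative data -/

/-- (plumbing; private copy of the parent's private lemma) Derivative data from `C²`. [cite: DemboZeitouni2010, §2.3 (lane plumbing)] -/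
private theorem derivData_of_contDiff_two'' {g : ℝ → ℝ} (hg : ContDiff ℝ 2 g) (τ : ℝ) :
    (∀ t, HasDerivAt g (deriv g t) t) ∧ (∀ t, HasDerivAt (deriv g) (deriv (deriv g) t) t) ∧
      Continuous (deriv (deriv g)) ∧ ∃ B, ∀ t ∈ Icc (-τ) τ, |deriv (deriv g) t| ≤ B := by
  have h1 : Differentiable ℝ g := hg.differentiable (by norm_num)
  have h2 : ContDiff ℝ 1 (deriv g) :=
    (contDiff_succ_iff_deriv.1 (show ContDiff ℝ ((1 : WithTop ℕ∞) + 1) g from hg)).2.2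
  have h3 : Differentiable ℝ (deriv g) := h2.differentiable (by norm_num)
  have h4 : Continuous (deriv (deriv g)) :=
    ((contDiff_succ_iff_deriv.1 (show ContDiff ℝ ((0 : WithTop ℕ∞) + 1) (deriv g) from h2)).2.2).continuous
  refine ⟨fun t => (h1 t).hasDerivAt, fun t => (h3 t).hasDerivAt, h4, ?_⟩
  obtain ⟨B, hB⟩ := isCompact_Icc.exists_bound_of_continuousOn (h4.continuousOn (s := Icc (-τ) τ))
  exact ⟨B, fun t ht => by simpa [Real.norm_eq_abs] using hB t ht⟩

/-- If `ψ(0) = 0`, `ψ' = ψ₁` with `ψ₁(0) = 0`, `ψ₁' = ψ₂` and `|ψ₂| ≤ η` on `[-δ, δ]`, then `|ψ(u)| ≤ η·u²` for `|u| ≤ δ` (two mean-value steps).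
[cite: DemboZeitouni2010, §2.3 (lane plumbing)] -/
private theorem abs_le_of_second_deriv_bound {ψ ψ₁ ψ₂ : ℝ → ℝ} {δ η : ℝ} (h0 : ψ 0 = 0) (h10 : ψ₁ 0 = 0)
    (hd : ∀ u, HasDerivAt ψ (ψ₁ u) u) (hd1 : ∀ u, HasDerivAt ψ₁ (ψ₂ u) u) (hη : ∀ u ∈ Icc (-δ) δ, |ψ₂ u| ≤ η)
    {u : ℝ} (hu : u ∈ Icc (-δ) δ) : |ψ u| ≤ η * u ^ 2 := by
  have hη0 : 0 ≤ η := by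
    have := hη 0 ⟨by linarith [hu.1, hu.2, abs_nonneg u], by linarith [hu.1, hu.2]⟩
    exact le_trans (abs_nonneg _) this
  -- `|ψ₁ v| ≤ η |v|` for `|v| ≤ |u|`
  have step1 : ∀ v, v ∈ Icc (-δ) δ → |ψ₁ v| ≤ η * |v| := by
    intro v hv
    rcases lt_trichotomy v 0 with hv0 | hv0 | hv0
    · obtain ⟨ξ, hξ, e⟩ := exists_hasDerivAt_eq_slope ψ₁ ψ₂ hv0 (fun t _ => (hd1 t).continuousAt.continuousWithinAt)
        (fun t _ => hd1 t)
      rw [h10] at e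
      have e' : ψ₁ v = ψ₂ ξ * v := by
        have : 0 - ψ₁ v = ψ₂ ξ * (0 - v) := by rw [e, div_mul_cancel₀ _ (sub_ne_zero.2 hv0.ne')]
        linarith
      rw [e', abs_mul]
      exact mul_le_mul_of_nonneg_right (hη ξ ⟨by linarith [hξ.1, hξ.2, hv.1, hv.2], by linarith [hξ.1, hξ.2, hv.1, hv.2]⟩) (abs_nonneg _)
    · subst hv0; rw [h10]; simp
    · obtain ⟨ξ, hξ, e⟩ := exists_hasDerivAt_eq_slope ψ₁ ψ₂ hv0 (fun t _ => (hd1 t).continuousAt.continuousWithinAt)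
        (fun t _ => hd1 t)
      rw [h10] at e
      have e' : ψ₁ v = ψ₂ ξ * v := by
        have : ψ₁ v - 0 = ψ₂ ξ * (v - 0) := by rw [e, div_mul_cancel₀ _ (sub_ne_zero.2 hv0.ne')]
        linarith
      rw [e', abs_mul]
      exact mul_le_mul_of_nonneg_right (hη ξ ⟨by linarith [hξ.1, hξ.2, hv.1, hv.2], by linarith [hξ.1, hξ.2, hv.1, hv.2]⟩) (abs_nonneg _)
  rcases lt_trichotomy u 0 with hu0 | hu0 | hu0
  · obtain ⟨ξ, hξ, e⟩ := exists_hasDerivAt_eq_slope ψ ψ₁ hu0 (fun t _ => (hd t).continuousAt.continuousWithinAt) (fun t _ => hd t)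
    rw [h0] at e
    have e' : ψ u = ψ₁ ξ * u := by
      have : 0 - ψ u = ψ₁ ξ * (0 - u) := by rw [e, div_mul_cancel₀ _ (sub_ne_zero.2 hu0.ne')]
      linarith
    have hξb := step1 ξ ⟨by linarith [hξ.1, hξ.2, hu.1, hu.2], by linarith [hξ.1, hξ.2, hu.1, hu.2]⟩
    rw [e', abs_mul]
    have : |ξ| ≤ |u| := by rw [abs_of_neg hξ.2, abs_of_neg hu0]; linarith [hξ.1]
    calc |ψ₁ ξ| * |u| ≤ η * |ξ| * |u| := mul_le_mul_of_nonneg_right hξb (abs_nonneg _)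
      _ ≤ η * |u| * |u| := by gcongr
      _ = η * u ^ 2 := by rw [mul_assoc, ← sq, sq_abs]
  · subst hu0; rw [h0]; simp
  · obtain ⟨ξ, hξ, e⟩ := exists_hasDerivAt_eq_slope ψ ψ₁ hu0 (fun t _ => (hd t).continuousAt.continuousWithinAt) (fun t _ => hd t)
    rw [h0] at e
    have e' : ψ u = ψ₁ ξ * u := by
      have : ψ u - 0 = ψ₁ ξ * (u - 0) := by rw [e, div_mul_cancel₀ _ (sub_ne_zero.2 hu0.ne')]
      linarith
    have hξb := step1 ξ ⟨by linarith [hξ.1, hξ.2, hu.1, hu.2], by linarith [hξ.1, hξ.2, hu.1, hu.2]⟩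
    rw [e', abs_mul]
    have : |ξ| ≤ |u| := by rw [abs_of_pos hξ.1, abs_of_pos hu0]; linarith [hξ.2]
    calc |ψ₁ ξ| * |u| ≤ η * |ξ| * |u| := mul_le_mul_of_nonneg_right hξb (abs_nonneg _)
      _ ≤ η * |u| * |u| := by gcongr
      _ = η * u ^ 2 := by rw [mul_assoc, ← sq, sq_abs]

/-! ## §2 ★★★ The Gaussian limit of the moment generating function of `(bc − N·b)/√N` -/

/-- `N/2 → ∞` along `ℕ`. [cite: DemboZeitouni2010, §2.3 (lane plumbing)] -/
private theorem tendsto_nat_div_two : Tendsto (fun N : ℕ => N / 2) atTop atTop :=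
  tendsto_atTop_atTop.2 fun b => ⟨2 * b, fun N h => by omega⟩

/-- ★★★ **GAUSSIAN ASYMPTOTICS OF THE CONTACT MGF.**  For all `y, z > 0` and every real `s`,
`E_{N,y,z} exp(s·(bc − N·b(y,z))/√N) = C_{1,N}(y e^{s/√N}, z)/C_{1,N}(y,z) · e^{−s√N·b} → exp(σ²s²/2)`,
`σ² = d/dA b(e^A, z)|_{A = log y}` (the variance rate of `tendsto_varContacts_div`): the moment generating functions of the
centred, `√N`-scaled contact number converge, on the whole real line, to those of the centred Gaussian of variance `σ²` — the
standard sufficient condition for the central limit theorem (Curtiss).  Proof: `log C_{1,N}(e^{A},z) = NΛ(A) + log A_{N mod 2}(e^A,z) + r_N(A)`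
with `sup_{|A−A₀|≤1}|r_N| ≤ ε_{⌊N/2⌋} → 0` (CAR «UNIFORM TWO-TERM ASYMPTOTICS»), `Λ ∈ C²` (second-order Taylor squeeze §1), `log A_c` continuous.
[cite: DemboZeitouni2010, §2.3 (Gärtner–Ellis; lane statement: local expansion of the free energy ⇒ Gaussian mgf); MadrasSlade1993, §1.1 eq. (1.1.4) p. 5; BeatonBousquetMelouDeGierDuminilCopinGuttmann2014, §3.2 Proposition 6 (arXiv v5 p. 10)] -/
theorem tendsto_contactMGF_gaussian (hy : 0 < y) (hz : 0 < z) (s : ℝ) :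
    Tendsto (fun N : ℕ => stripZ₂ 1 N (y * Real.exp (s / Real.sqrt N)) z / stripZ₂ 1 N y z
        * Real.exp (-(s * Real.sqrt N * contactB y z))) atTop
      (𝓝 (Real.exp (deriv (fun A => contactB (Real.exp A) z) (Real.log y) * s ^ 2 / 2))) := by
  set A₀ := Real.log y with hA₀
  set B := Real.log z with hBdef
  have hyA : Real.exp A₀ = y := Real.exp_log hy
  have hzB : Real.exp B = z := Real.exp_log hz
  obtain ⟨Λ, hΛdef⟩ : ∃ Λ : ℝ → ℝ, Λ = fun A => Real.log (stripMuY₂ 1 (Real.exp A) (Real.exp B)) := ⟨_, rfl⟩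
  have hΛ2 : ContDiff ℝ 2 Λ := by rw [hΛdef]; exact (contDiff_two_log_stripMuY₂_exp B).1
  have hΛd : deriv Λ = fun A => contactB (Real.exp A) (Real.exp B) := by rw [hΛdef]; exact (contDiff_two_log_stripMuY₂_exp B).2
  obtain ⟨hΛ1, hΛ11, hΛ2c, -⟩ := derivData_of_contDiff_two'' hΛ2 1
  set b := contactB y z with hb
  set σ2 := deriv (deriv Λ) A₀ with hσ2
  have hσ : deriv (fun A => contactB (Real.exp A) z) (Real.log y) = σ2 := by
    rw [hσ2, hΛd, hzB]
  have hbΛ : deriv Λ A₀ = b := by rw [hΛd]; simp only [hyA, hzB, hb]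
  -- the scale `u_N = s/√N`
  set u : ℕ → ℝ := fun N => s / Real.sqrt N with hu
  have hu0 : Tendsto u atTop (𝓝 0) := by
    have h1 : Tendsto (fun N : ℕ => Real.sqrt (N : ℝ)) atTop atTop :=
      Real.tendsto_sqrt_atTop.comp tendsto_natCast_atTop_atTop
    have := h1.inv_tendsto_atTop.const_mul s
    rw [mul_zero] at this
    exact this.congr fun N => by simp [hu, div_eq_mul_inv]
  have huN : ∀ N : ℕ, 1 ≤ N → (N : ℝ) * u N = s * Real.sqrt N ∧ (N : ℝ) * u N ^ 2 = s ^ 2 := by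
    intro N hN
    have hN0 : (0 : ℝ) < N := by exact_mod_cast hN
    have hs : Real.sqrt (N : ℝ) ≠ 0 := (Real.sqrt_pos.2 hN0).ne'
    have hNN : (N : ℝ) = Real.sqrt N * Real.sqrt N := (Real.mul_self_sqrt hN0.le).symm
    constructor
    · show (N : ℝ) * (s / Real.sqrt N) = s * Real.sqrt N
      nth_rewrite 1 [hNN]; field_simp
    · show (N : ℝ) * (s / Real.sqrt N) ^ 2 = s ^ 2
      rw [div_pow, Real.sq_sqrt hN0.le]; field_simp
  -- the second-order Taylor remainder of `Λ` at `A₀`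
  set ψ : ℝ → ℝ := fun v => Λ (A₀ + v) - Λ A₀ - b * v - σ2 * (v * v) / 2 with hψ
  set ψ1 : ℝ → ℝ := fun v => deriv Λ (A₀ + v) - b - σ2 * v with hψ1
  set ψ2 : ℝ → ℝ := fun v => deriv (deriv Λ) (A₀ + v) - σ2 with hψ2
  have hshift : ∀ t, HasDerivAt (fun t : ℝ => A₀ + t) 1 t := fun t => by simpa using (hasDerivAt_id t).const_add A₀
  have hψd : ∀ v, HasDerivAt ψ (ψ1 v) v := by
    intro v
    have h1 : HasDerivAt (fun v => Λ (A₀ + v)) (deriv Λ (A₀ + v)) v := by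
      have h := (hΛ1 (A₀ + v)).comp v (hshift v); rw [mul_one] at h; exact h
    have h2 : HasDerivAt (fun v : ℝ => b * v) b v := by simpa using (hasDerivAt_id v).const_mul b
    have h3 : HasDerivAt (fun v : ℝ => σ2 * (v * v) / 2) (σ2 * v) v := by
      have h := (((hasDerivAt_id' v).mul (hasDerivAt_id' v)).const_mul σ2).div_const 2
      exact h.congr_deriv (by ring)
    have h4 : HasDerivAt (fun v => Λ (A₀ + v) - Λ A₀ - b * v - σ2 * (v * v) / 2) (deriv Λ (A₀ + v) - b - σ2 * v) v :=
      ((h1.sub_const (Λ A₀)).sub h2).sub h3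
    exact h4
  have hψ1d : ∀ v, HasDerivAt ψ1 (ψ2 v) v := by
    intro v
    have h1 : HasDerivAt (fun v => deriv Λ (A₀ + v)) (deriv (deriv Λ) (A₀ + v)) v := by
      have h := (hΛ11 (A₀ + v)).comp v (hshift v); rw [mul_one] at h; exact h
    have h3 : HasDerivAt (fun v : ℝ => σ2 * v) σ2 v := by simpa using (hasDerivAt_id v).const_mul σ2
    have h4 : HasDerivAt (fun v => deriv Λ (A₀ + v) - b - σ2 * v) (deriv (deriv Λ) (A₀ + v) - σ2) v :=
      (h1.sub_const b).sub h3
    exact h4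
  have hψ0 : ψ 0 = 0 := by simp [hψ]
  have hψ10 : ψ1 0 = 0 := by simp [hψ1, hbΛ]
  -- T1: `N ψ(u_N) → 0`
  have T1 : Tendsto (fun N : ℕ => (N : ℝ) * ψ (u N)) atTop (𝓝 0) := by
    rw [Metric.tendsto_atTop]
    intro e he
    have hη : 0 < e / (s ^ 2 + 1) := by positivity
    -- continuity of `Λ''` at `A₀`: `|ψ2 v| ≤ η` for `|v| ≤ δ`
    have hc : ContinuousAt ψ2 0 := by
      have : Continuous ψ2 := by
        rw [hψ2]; exact (hΛ2c.comp (continuous_const.add continuous_id)).sub continuous_const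
      exact this.continuousAt
    have hψ20 : ψ2 0 = 0 := by simp [hψ2, hσ2]
    obtain ⟨δ, hδ, hδb⟩ := (Metric.continuousAt_iff.1 hc) (e / (s ^ 2 + 1)) hη
    have hbound : ∀ v ∈ Icc (-(δ / 2)) (δ / 2), |ψ2 v| ≤ e / (s ^ 2 + 1) := by
      intro v hv
      have : dist v 0 < δ := by rw [Real.dist_eq, sub_zero]; exact lt_of_le_of_lt (abs_le.2 ⟨hv.1, hv.2⟩) (by linarith)
      have h := hδb this
      rw [hψ20, Real.dist_eq, sub_zero] at h
      exact h.le
    obtain ⟨N₀, hN₀⟩ := (Metric.tendsto_atTop.1 hu0) (δ / 2) (by positivity)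
    refine ⟨max N₀ 1, fun N hN => ?_⟩
    have hN1 : 1 ≤ N := le_trans (le_max_right _ _) hN
    have huδ : u N ∈ Icc (-(δ / 2)) (δ / 2) := by
      have := hN₀ N (le_trans (le_max_left _ _) hN)
      rw [Real.dist_eq, sub_zero] at this
      exact ⟨by linarith [neg_abs_le (u N)], by linarith [le_abs_self (u N)]⟩
    have hψb := abs_le_of_second_deriv_bound hψ0 hψ10 hψd hψ1d hbound huδ
    rw [Real.dist_eq, sub_zero, abs_mul, abs_of_nonneg (Nat.cast_nonneg N)]
    calc (N : ℝ) * |ψ (u N)| ≤ (N : ℝ) * (e / (s ^ 2 + 1) * u N ^ 2) := mul_le_mul_of_nonneg_left hψb (Nat.cast_nonneg N)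
      _ = e / (s ^ 2 + 1) * ((N : ℝ) * u N ^ 2) := by ring
      _ = e / (s ^ 2 + 1) * s ^ 2 := by rw [(huN N hN1).2]
      _ < e := by
          rw [div_mul_eq_mul_div, div_lt_iff₀ (by positivity)]
          nlinarith
  -- T2: the amplitude correction is continuous at `A₀`
  set LA : ℕ → ℝ → ℝ := fun c v => Real.log (parityAmplitude c (Real.exp (A₀ + v)) (Real.exp B)) with hLA
  have T2 : ∀ c, c < 2 → Tendsto (fun N : ℕ => LA c (u N) - LA c 0) atTop (𝓝 0) := by
    intro c hc
    have hG2 := contDiff_two_parityG A₀ B hc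
    have hcont : Continuous (LA c) := by
      have h1 : Continuous (fun t => (c : ℝ) * Real.log (stripMuY₂ 1 (Real.exp (A₀ + t)) (Real.exp B))
          + Real.log (parityAmplitude c (Real.exp (A₀ + t)) (Real.exp B))) := hG2.continuous
      have h2 : Continuous (fun t => (c : ℝ) * Λ (A₀ + t)) :=
        continuous_const.mul (hΛ2.continuous.comp (continuous_const.add continuous_id))
      have e : LA c = fun t => ((c : ℝ) * Real.log (stripMuY₂ 1 (Real.exp (A₀ + t)) (Real.exp B))
          + Real.log (parityAmplitude c (Real.exp (A₀ + t)) (Real.exp B))) - (c : ℝ) * Λ (A₀ + t) := by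
        funext t; simp only [hLA, hΛdef]; ring
      rw [e]; exact h1.sub h2
    have := ((hcont.tendsto 0).comp hu0).sub_const (LA c 0)
    rwa [Function.comp_def, sub_self] at this
  -- T3: the uniform remainders
  set y₁ := Real.exp (A₀ - 1) with hy₁def
  set y₂ := Real.exp (A₀ + 1) with hy₂def
  have hy₁ : 0 < y₁ := Real.exp_pos _
  have h12 : y₁ ≤ y₂ := Real.exp_le_exp.2 (by linarith)
  have hrem : ∀ c, c < 2 → ∃ ε : ℕ → ℝ, Tendsto ε atTop (𝓝 0) ∧ ∀ M : ℕ, ∀ y' ∈ Icc y₁ y₂,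
      |Real.log (stripZ₂ 1 (2 * M + c) y' z) - (2 * M + c) * Real.log (stripMuY₂ 1 y' z) - Real.log (parityAmplitude c y' z)| ≤ ε M := by
    intro c hc
    obtain ⟨a₁, a₂, ha₁, hA⟩ := parityAmplitude_bounds hz hy₁ h12 hc
    obtain ⟨ε, hεlim, hεb⟩ := exists_uniform_log_two_term hz hy₁ h12 hc ha₁ hA
      (fun y' hy' => tendsto_parityAmplitude (lt_of_lt_of_le hy₁ hy'.1) hz hc)
    refine ⟨ε, ?_, hεb⟩
    have hε0 : ∀ M, 0 ≤ ε M := fun M => le_trans (abs_nonneg _) (hεb M y₁ ⟨le_rfl, h12⟩)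
    refine squeeze_zero' (Filter.Eventually.of_forall hε0) ?_ hεlim
    filter_upwards [eventually_ge_atTop 1] with M hM
    have hM1' : (1 : ℝ) ≤ M := by exact_mod_cast hM
    nlinarith [hε0 M]
  obtain ⟨ε0, hε0lim, hε0b⟩ := hrem 0 (by norm_num)
  obtain ⟨ε1, hε1lim, hε1b⟩ := hrem 1 (by norm_num)
  have hmemI : ∀ v : ℝ, |v| ≤ 1 → Real.exp (A₀ + v) ∈ Icc y₁ y₂ := fun v hv =>
    ⟨Real.exp_le_exp.2 (by linarith [neg_abs_le v]), Real.exp_le_exp.2 (by linarith [le_abs_self v])⟩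
  -- the total error bound
  set bound : ℕ → ℝ := fun N => |(N : ℝ) * ψ (u N)| + (|LA 0 (u N) - LA 0 0| + |LA 1 (u N) - LA 1 0|)
      + 2 * (|ε0 (N / 2)| + |ε1 (N / 2)|) with hbound
  have hbound0 : Tendsto bound atTop (𝓝 0) := by
    have a := T1.abs
    have b0 := (T2 0 (by norm_num)).abs
    have b1 := (T2 1 (by norm_num)).abs
    have c0 := (hε0lim.comp tendsto_nat_div_two).abs
    have c1 := (hε1lim.comp tendsto_nat_div_two).abs
    simp only [abs_zero] at a b0 b1 c0 c1
    have := (a.add (b0.add b1)).add ((c0.add c1).const_mul 2)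
    simp only [add_zero, mul_zero] at this
    exact this
  -- the key estimate, eventually in `N`
  have hkey : ∀ᶠ N : ℕ in atTop,
      |Real.log (stripZ₂ 1 N (y * Real.exp (u N)) z / stripZ₂ 1 N y z * Real.exp (-(s * Real.sqrt N * b))) - σ2 * s ^ 2 / 2|
        ≤ bound N := by
    obtain ⟨N₀, hN₀⟩ := (Metric.tendsto_atTop.1 hu0) 1 one_pos
    filter_upwards [eventually_ge_atTop (max N₀ 1)] with N hN
    have hN1 : 1 ≤ N := le_trans (le_max_right _ _) hN
    have huv : |u N| ≤ 1 := by
      have := hN₀ N (le_trans (le_max_left _ _) hN); rw [Real.dist_eq, sub_zero] at this; exact this.le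
    -- parity split `N = 2M + c`
    obtain ⟨M, c, hc, hNMc⟩ : ∃ M c : ℕ, c < 2 ∧ N = 2 * M + c := ⟨N / 2, N % 2, Nat.mod_lt _ (by norm_num), (Nat.div_add_mod N 2).symm⟩
    have hMdiv : N / 2 = M := by omega
    -- positivity
    have hC1 := stripZ₂_pos 1 N (mul_pos hy (Real.exp_pos (u N))) hz
    have hC0 := stripZ₂_pos 1 N hy hz
    have hE := Real.exp_pos (-(s * Real.sqrt N * b))
    -- the two remainder bounds (at `y e^{u}` and at `y`)
    have ey1 : y * Real.exp (u N) = Real.exp (A₀ + u N) := by rw [Real.exp_add, hyA]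
    have ey0 : y = Real.exp (A₀ + 0) := by rw [add_zero, hyA]
    have eNr : (N : ℝ) = 2 * (M : ℝ) + c := by rw [hNMc]; push_cast; ring
    have hrem2 : ∀ v : ℝ, |v| ≤ 1 →
        |Real.log (stripZ₂ 1 N (Real.exp (A₀ + v)) z) - N * Λ (A₀ + v) - LA c v| ≤ |ε0 (N / 2)| + |ε1 (N / 2)| := by
      intro v hv
      have eΛ : Λ (A₀ + v) = Real.log (stripMuY₂ 1 (Real.exp (A₀ + v)) z) := by rw [hΛdef, hzB]
      have eL : LA c v = Real.log (parityAmplitude c (Real.exp (A₀ + v)) z) := by rw [hLA, hzB]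
      rw [eΛ, eL, hMdiv, eNr]
      interval_cases c
      · have key := hε0b M _ (hmemI v hv)
        rw [← hNMc] at key
        push_cast at key ⊢
        simp only [add_zero] at key ⊢
        exact le_trans key (by linarith [le_abs_self (ε0 M), abs_nonneg (ε1 M)])
      · have key := hε1b M _ (hmemI v hv)
        rw [← hNMc] at key
        push_cast at key ⊢
        exact le_trans key (by linarith [le_abs_self (ε1 M), abs_nonneg (ε0 M)])
    have hr1 := hrem2 (u N) huv
    have hr0 := hrem2 0 (by simp)
    -- the algebra: `log M_N − σ²s²/2 = Nψ(u) + (LA c (u) − LA c 0) + (r₁ − r₀)`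
    have hlog : Real.log (stripZ₂ 1 N (y * Real.exp (u N)) z / stripZ₂ 1 N y z * Real.exp (-(s * Real.sqrt N * b)))
        = Real.log (stripZ₂ 1 N (Real.exp (A₀ + u N)) z) - Real.log (stripZ₂ 1 N (Real.exp (A₀ + 0)) z) - s * Real.sqrt N * b := by
      rw [Real.log_mul (div_pos hC1 hC0).ne' hE.ne', Real.log_div hC1.ne' hC0.ne', Real.log_exp, ey1, ← ey0]
      ring
    obtain ⟨e1, e2⟩ := huN N hN1
    have hid : Real.log (stripZ₂ 1 N (Real.exp (A₀ + u N)) z) - Real.log (stripZ₂ 1 N (Real.exp (A₀ + 0)) z)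
          - s * Real.sqrt N * b - σ2 * s ^ 2 / 2
        = (N : ℝ) * ψ (u N) + (LA c (u N) - LA c 0)
          + ((Real.log (stripZ₂ 1 N (Real.exp (A₀ + u N)) z) - N * Λ (A₀ + u N) - LA c (u N))
            - (Real.log (stripZ₂ 1 N (Real.exp (A₀ + 0)) z) - N * Λ (A₀ + 0) - LA c 0)) := by
      simp only [hψ, add_zero]
      have e1' : s * Real.sqrt N * b = (N : ℝ) * u N * b := by rw [e1]
      have e2' : σ2 * s ^ 2 / 2 = (N : ℝ) * u N ^ 2 * σ2 / 2 := by rw [e2]; ring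
      rw [e1', e2']
      ring
    rw [hlog, hid, hbound]
    have hcases : |LA c (u N) - LA c 0| ≤ |LA 0 (u N) - LA 0 0| + |LA 1 (u N) - LA 1 0| := by
      interval_cases c
      · linarith [abs_nonneg (LA 1 (u N) - LA 1 0)]
      · linarith [abs_nonneg (LA 0 (u N) - LA 0 0)]
    calc |(N : ℝ) * ψ (u N) + (LA c (u N) - LA c 0)
          + ((Real.log (stripZ₂ 1 N (Real.exp (A₀ + u N)) z) - N * Λ (A₀ + u N) - LA c (u N))
            - (Real.log (stripZ₂ 1 N (Real.exp (A₀ + 0)) z) - N * Λ (A₀ + 0) - LA c 0))|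
        ≤ |(N : ℝ) * ψ (u N)| + |LA c (u N) - LA c 0|
          + (|Real.log (stripZ₂ 1 N (Real.exp (A₀ + u N)) z) - N * Λ (A₀ + u N) - LA c (u N)|
            + |Real.log (stripZ₂ 1 N (Real.exp (A₀ + 0)) z) - N * Λ (A₀ + 0) - LA c 0|) := by
          refine le_trans (abs_add_le _ _) (add_le_add (abs_add_le _ _) (abs_sub _ _))
      _ ≤ _ := by linarith [hcases, hr1, hr0]
  -- conclude: `log M_N → σ²s²/2`, hence `M_N = exp(log M_N) → exp(σ²s²/2)`
  have hlogT : Tendsto (fun N : ℕ => Real.log (stripZ₂ 1 N (y * Real.exp (u N)) z / stripZ₂ 1 N y z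
      * Real.exp (-(s * Real.sqrt N * b)))) atTop (𝓝 (σ2 * s ^ 2 / 2)) := by
    have hb0 : ∀ N, 0 ≤ bound N := fun N => by simp only [hbound]; positivity
    have h := squeeze_zero_norm' (hkey.mono fun N hN => by rw [Real.norm_eq_abs]; exact hN) hbound0
    exact tendsto_sub_nhds_zero_iff.1 h
  have hexpT := (Real.continuous_exp.tendsto _).comp hlogT
  rw [hσ]
  rw [show deriv (deriv Λ) A₀ * s ^ 2 / 2 = σ2 * s ^ 2 / 2 by rw [hσ2]] 
  refine hexpT.congr' ?_
  filter_upwards [eventually_ge_atTop 1] with N hN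
  have hC1 := stripZ₂_pos 1 N (mul_pos hy (Real.exp_pos (u N))) hz
  have hC0 := stripZ₂_pos 1 N hy hz
  simp only [Function.comp_apply, hu]
  exact Real.exp_log (mul_pos (div_pos hC1 hC0) (Real.exp_pos _))

end WidthOneYZ

end Literature.Probability.RandomPlanarGeometry.SAW.HexBW
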